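import Summits.BirchSwinnertonDyer.Rank1Residual.X2.ClassClosureO9
import Literature.NumberTheory.EllipticCurves.Kato2004.PerrinRiouRatio
import HarnessLib

/-!
# Route `EisensteinPrimes`, crux 3 `MazurMCOnCellB` (stmt-BirchSwinnertonDyer-19033), line `katopoint`:
# the ONE typed statement the line posits — the exceptional Rubin formula in valuation currency — as an importable
# module (definition; cell `bsd-eis`, width seat bsd-line-x2-p1-w5 g2; `--supports stmt-BirchSwinnertonDyer-19033`)

WHY THIS FILE. The line `katopoint` (ideator bsd-idea-12 g10; workfile `Cruxes/MazurMCOnCellB/Lines/katopoint.lean`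
v1.1, published, NOT registered) factors the registered skeleton `twistback` v5's ROAD stub
`stub_exceptionalLeadingTermSplitGV : ∀ V ℓ, X2.CellCSplitGV V ℓ → X2.O9.ExceptionalLeadingTermAt V ℓ` as
(R) `ExcRubinFormulaAt V ℓ` × (PR) `Rank1Residual.Additive.PerrinRiouUpToUnitAt Kato2004.PRRatio V ℓ`, the glue being
kernel-checked. The predicate (R) is DECLARED LOCALLY in that workfile; a workfile is not a tree module, so no
`Theorems/` file can prove or consume a stub naming (R) BY NAME until the predicate lives in an importable module with
the same meaning (LEAD bsd-line-x2-p1 g12, `Lines/twistback-lead-verdict-g12.md` §3 (1), §4 item 3: prerequisite of a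
v6 that splits stub 5). This file is that module: the predicate VERBATIM (binders and body unchanged), nothing else.
The companion `Theorems/EisensteinPrimesMazurMCOnCellBKatopointFactorisation.lean` carries the glue theorems.

HONEST FRAMING. ONE definition (a `Prop` with parameters `W`, `p`, tagged `@[conjecture]` = open typed statement /
obligation node, as `X2.O9.ExceptionalLeadingTermAt`) + its `Iff.rfl` unfolding lemma; no named fact, no instance,
no notation, no `sorry`. Nothing about Kato's zeta element, the Mazur–Tate–Teitelbaum function, Perrin-Riou's
conjecture, the exceptional-zero conjecture, the Mazur main conjecture or BSD is asserted. Whether (R) HOLDS on the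
split Greenberg–Vatsal half of X2c is exactly the line's stub `stub_excRubinSplitGV` (print for `ℓ > 3`,
`V(ℚ)[ℓ] = 0`: Büyükboduk 2016 Thm. B; print-assemblable at `ℓ = 3` — see the docstring); it is not claimed here.

## The object

* `ExcRubinFormulaAt W p` — binder for binder the tree's typed conjectured target
  `Summit.BirchSwinnertonDyer.Rank1Residual.X2.O9.ExceptionalLeadingTermAt W p` (`X2/ClassClosureO9.lean`) with the
  analytic order of `Ш` (`s`, `shaAn W = s`) REPLACED by a Perrin-Riou ratio `ℒ` of Kato's zeta element
  (`Literature.NumberTheory.EllipticCurves.Kato2004.PRRatio W p ℒ`, the tree's CLOSED, value-pinned predicate,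
  `Literature/NumberTheory/EllipticCurves/Kato2004/PerrinRiouRatio.lean`) and the torsion / Tamagawa factors dropped:
  `Reg_p(Dh) ≠ 0 → ℒ ≠ 0 → ord_{T=0} L = 2 ∧ ord_p(ϖ·[T²]L·log_p(γ)²) = ord_p(𝓛_p(Dq)·Reg_p(Dh)·ℒ)`.

References: B. Mazur, J. Tate, J. Teitelbaum, Invent. Math. 84 (1986), §I.13, §II.10 [MazurTateTeitelbaum1986Invent];
K. Kato, Astérisque 295 (2004), Thm. 12.5, Thm. 16.6 [Kato2004Asterisque]; D. Burns, M. Kurihara, T. Sano,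
arXiv:1910.07404, Conj. 2.8 (p. 10) [BurnsKuriharaSano2019]; W. Stein, C. Wuthrich, Math. Comp. 82 (2013), §4.2,
Thm. 6.1 [SteinWuthrich2013]; K. Büyükboduk, IMRN 2016 no. 7, 2197–2237 (= arXiv:1405.2643), Thm. B;
R. Venerucci, PhD thesis (Milano 2013), Prop. 12.28, Cor. 12.29, Cor. 12.32; tree: `X2/ClassClosureO9.lean`
(`O9.ExceptionalLeadingTermAt`), `Kato2004/PerrinRiouRatio.lean` (`PRRatio`),
`Rank1Residual/Additive/KatoDescentRankOnePerrinRiou.lean` (`PerrinRiouUpToUnitAt`),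
`Cruxes/MazurMCOnCellB/Lines/katopoint.lean` §0 (the source of this text), `Cruxes/MazurMCOnCellB/EMBED-NOTES-g10.md`.
-/

set_option autoImplicit false

-- `Summit.BirchSwinnertonDyer.BirchSwinnertonDyer.…`: the summit and its single sub-problem share a name.
set_option linter.dupNamespace false

noncomputable section

open scoped Classical MatrixGroups ModularForm

open PowerSeries CongruenceSubgroup WeierstrassCurve
  Literature.NumberTheory.EllipticCurves
  Literature.NumberTheory.EllipticCurves.ModularForms
  Literature.NumberTheory.EllipticCurves.Rank1Residual
  Literature.NumberTheory.EllipticCurves.Rank1Residual.Typed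
  Literature.NumberTheory.EllipticCurves.SteinWuthrich2013

namespace Summit.BirchSwinnertonDyer.BirchSwinnertonDyer.Theorems.EisensteinPrimesMazurMCOnCellBKatopointDefs

/-- **(R) `ExcRubinFormulaAt W p` — the RUBIN–BÜYÜKBODUK–VENERUCCI exceptional height formula for Kato's zeta element,
`Ω_W`-currency, valuation form** (VERBATIM the predicate of `Cruxes/MazurMCOnCellB/Lines/katopoint.lean` §0). Binder
for binder the tree's `X2.O9.ExceptionalLeadingTermAt W p` with `#Ш_an` REPLACED by the Perrin-Riou ratio: for every
`ℒ` with `Kato2004.PRRatio W p ℒ` (= «`ℒ = log_ω(loc_p z†)·(Ω⁺_f/Ω_W) / (∏_{ℓ∣pA} P_ℓ(ℓ⁻¹) · log_ω(x)²)` for Kato's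
value-pinned zeta element `z†` and a generator `x` of `W(ℚ)/tors`»), every cyclotomic datum `(κ, γ)`, the newform `f`
of `W` with `ϖ·Ω_W = Ω⁺_f`, THE split-multiplicative Mazur–Tate–Teitelbaum function `L` of `f`, a Tate-parameter
datum `Dq` and THE Stein–Wuthrich §4.2 canonical height `Dh`:
`Reg_p(Dh) ≠ 0 → ℒ ≠ 0 → ord_{T=0} L = 2 ∧ ord_p(ϖ·[T²]L·log_p(γ)²) = ord_p(𝓛_p(Dq)·Reg_p(Dh)·ℒ)`.
PRINTED ANTECEDENTS (exact identities, of which this is the valuation): Büyükboduk IMRN 2016 Thm. B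
(`½ L_p″(E,1) ⊗ γ₀ = −λ_BK⁻¹·⟨Z̃_BK, Z̃_BK⟩_Nek`; hypotheses `p > 3`, split multiplicative, `r_an = 1`, `E(ℚ)[p] = 0`,
Nekovář height non-degenerate; NO image hypothesis) and Venerucci's thesis Prop. 12.28 / Cor. 12.32
(`½L_p″(u,1) = −(1−p⁻¹)⁻¹·𝓛_p(A)·(log_A u_0/log_A(P)²)·⟨P,P⟩^{Sch}` for `u = z^{Kato}`); the factor `(1−p⁻¹)` is the
`ℓ = p` Euler factor `P_p(p⁻¹) = 1 − a_p/p` inside `PRRatio`'s depletion product, the `ℓ ≠ p` factors are the values at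
`𝟙` of Kato's `{pA}`-depletion (non-zero by Hasse), `½·d²/ds² ↔ [T²]·log_p(γ)²` (MTT §I.13), `ϖ` converts the
`Ω_A`-normalisation to the tree's `Ω⁺_f`-normalised `L`. WHY IT MIGHT FAIL AS TYPED: a normalisation slip between
`PRRatio`'s conjuncts (Z0)–(Z5) and the printed formula (a rational factor of non-zero `p`-adic valuation, e.g. a
Tamagawa-type index in Nekovář's comparison `H̃¹_f ↔ Sel`, would falsify the valuation identity at finitely many
pairs); at `p = 3` / `E(ℚ)[p] ≠ 0` the printed proofs must be re-run in `E(ℚ) ⊗ ℚ_p` (no reference states it).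
A `Prop` with parameters; nothing asserted; whether it holds on X2c ∩ split ∩ `GVPar` is the line's stub
`stub_excRubinSplitGV`, not claimed anywhere in the tree.
TAG: `@[conjecture]` — like the tree's `X2.O9.ExceptionalLeadingTermAt` and `Additive.PerrinRiouUpToUnitAt` it is
an OPEN typed statement of our theories at a general pair (an obligation node, provable / refutable by name per pair;
a consequence of the exceptional-zero `p`-adic BSD conjecture of Mazur–Tate–Teitelbaum §II.10 together with
Perrin-Riou's conjecture, and a theorem in print only under the hypotheses above), not a vendored fact.
[cite: MazurTateTeitelbaum1986Invent, §I.13 and §II.10] [cite: Kato2004Asterisque, Thm. 16.6 (reciprocity law)]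
[cite: BurnsKuriharaSano2019, Conj. 2.8 (ii) (p. 10) (the ratio ℒ)] [cite: SteinWuthrich2013, §4.2 and Thm. 6.1] -/
@[conjecture] def ExcRubinFormulaAt (W : WeierstrassCurve ℚ) [W.IsElliptic] [W.IsGloballyMinimal] (p : ℕ)
    [Fact p.Prime] : Prop :=
  ∀ (ℒ : ℚ_[p]), Kato2004.PRRatio W p ℒ →
  ∀ (κ : ZpExtension ℚ p) (γ : Field.absoluteGaloisGroup ℚ),
      κ.IsCyclotomic → κ.IsTopGenerator γ → IsCyclotomicVariable p γ →
    ∀ ⦃N : ℕ⦄ [NeZero N] (f : CuspForm (Gamma0 N) 2), IsNewformOf W f →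
    ∀ (ϖ : ℚ), (ϖ : ℝ) * W.realPeriodRat = plusPeriod f →
    ∀ (L : PowerSeries ℚ_[p]), IsSplitMultPAdicLFunctionOf f p L →
    ∀ (Dq : TateParameterData W p) (Dh : PAdicHeightData W p), IsSplitMultCanonical Dh Dq →
      padicRegulator Dh ≠ 0 → ℒ ≠ 0 →
        L.order = ((2 : ℕ) : ℕ∞) ∧
        (((ϖ : ℚ) : ℚ_[p]) * PowerSeries.coeff 2 L * padicLog p (cyclotomicGenerator p) ^ 2).valuation =
          (LInvariant Dq * padicRegulator Dh * ℒ).valuation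

/-- Unfolding lemma: `ExcRubinFormulaAt W p` is by definition the displayed `∀`-statement (for `rw`/`simp only` in
consumers that state the hypothesis in expanded form). [folklore] -/
theorem excRubinFormulaAt_iff (W : WeierstrassCurve ℚ) [W.IsElliptic] [W.IsGloballyMinimal] (p : ℕ) [Fact p.Prime] :
    ExcRubinFormulaAt W p ↔
      ∀ (ℒ : ℚ_[p]), Kato2004.PRRatio W p ℒ →
      ∀ (κ : ZpExtension ℚ p) (γ : Field.absoluteGaloisGroup ℚ),
          κ.IsCyclotomic → κ.IsTopGenerator γ → IsCyclotomicVariable p γ →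
        ∀ ⦃N : ℕ⦄ [NeZero N] (f : CuspForm (Gamma0 N) 2), IsNewformOf W f →
        ∀ (ϖ : ℚ), (ϖ : ℝ) * W.realPeriodRat = plusPeriod f →
        ∀ (L : PowerSeries ℚ_[p]), IsSplitMultPAdicLFunctionOf f p L →
        ∀ (Dq : TateParameterData W p) (Dh : PAdicHeightData W p), IsSplitMultCanonical Dh Dq →
          padicRegulator Dh ≠ 0 → ℒ ≠ 0 →
            L.order = ((2 : ℕ) : ℕ∞) ∧
            (((ϖ : ℚ) : ℚ_[p]) * PowerSeries.coeff 2 L * padicLog p (cyclotomicGenerator p) ^ 2).valuation =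
              (LInvariant Dq * padicRegulator Dh * ℒ).valuation :=
  Iff.rfl

end Summit.BirchSwinnertonDyer.BirchSwinnertonDyer.Theorems.EisensteinPrimesMazurMCOnCellBKatopointDefs

end
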